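import Literature.Computability.Cryptography.GoldreichLevinInverter
import Literature.Computability.Cryptography.GoldreichLevinBricks
import Literature.Computability.Cryptography.LiuPassLemma53Programs
import Literature.Computability.Complexity.FoldBricks
import HarnessLib

/-!
# The Goldreich–Levin inverter is polynomial time (the `FP` program; discharge of `glInvRun_polyTime`)

Machine layer, part 2: the run function `GLInv.run` of the Goldreich–Levin inverter
(`GoldreichLevinInverter.lean`) as a pipeline of `FP` bricks with two nested clocked loops around
one call of the distinguisher `D` — the pattern of `LiuPassCondRedProgram.lean` /
`LiuPassLemma53HidingProgram.lean`, with the string model of `GoldreichLevinDecoder.lean` as the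
specification of every stage:

* the context record `ctxF` (unary parameters `1ⁿ, 1ᵏ, 1^{2^k−1}`, the coin fields, and the
  predictor's precomputed data: the flag `[K ≤ j₀]`, the parity of the selected `v`-bits, the
  prefix / masked xor / block `j₀` / suffix of `ω'`), `ctxF_boolPair`;
* the predictor `predF` (`= predStr`), the vote round `voteRound` and the vote loop (`= voteCount`),
  the coordinate round `bitRound` and the outer loop (`= candStr`);
* `glRunF_boolPair : glRunF ⟨inp, c⟩ = GLInv.run D q_D d e inp c`, `glRunF_mem_FP`, and
  **`GLInv.glInvRun_polyTime_holds`**.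

## References

* O. Goldreich, *Foundations of Cryptography I*, CUP 2001, Thm 2.5.6 (proof: the inverter runs in
  polynomial time).
* S. Arora, B. Barak, *Computational Complexity: A Modern Approach*, CUP 2009, Thm 9.12, §1.3–1.4.
-/

namespace Literature.Computability.Cryptography

open _root_.Computability Polynomial Complexity Complexity.Brick Complexity.Plumb Complexity.OracleCompose
  Complexity.HashBricks Complexity.PRelSigma CondRed GLDec GLBricks GLInv

namespace GLProg

variable (D : RandAlg (List Bool) Bool) (qD : Polynomial ℕ) (d e : ℕ)

/-! ### Parsing and the unary parameters (on `z = ⟨⟨a, y⟩, c⟩`, `n = |a|`) -/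

/-- `1ⁿ`. [folklore] -/
noncomputable def uN : List Bool → List Bool := onesFn ∘ fstF ∘ fstF
/-- `y`. [folklore] -/
def yF : List Bool → List Bool := sndF ∘ fstF
/-- `1^{⌊log₂ n⌋}`. [folklore] -/
noncomputable def lgU : List Bool → List Bool := logU ∘ uN
/-- `1^K`, `K = d⌊log₂ n⌋`. [folklore] -/
noncomputable def KU : List Bool → List Bool := umulFn ∘ fanoutFn (fun _ => ones d) lgU
/-- `1^k`, `k = (2e+1)(⌊log₂ n⌋+1) + 1`. [folklore] -/
noncomputable def kU : List Bool → List Bool :=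
  List.cons true ∘ umulFn ∘ fanoutFn (fun _ => ones (2 * e + 1)) (List.cons true ∘ lgU)
/-- The ruler `1^{2^{2e+2}(n+1)^{2e+1}}` (`≥ 2^k`). [folklore] -/
noncomputable def rulerU : List Bool → List Bool := polyFn (C (2 ^ (2 * e + 2)) * (X + 1) ^ (2 * e + 1)) ∘ uN
/-- `1^{2^k − 1}` (the binary numeral `1ᵏ` read in unary under the ruler). [folklore] -/
noncomputable def twoKm1 : List Bool → List Bool := binToUnaryFn ∘ fanoutFn (rulerU e) (kU e)
/-- `1^{Kn}`. [folklore] -/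
noncomputable def KnU : List Bool → List Bool := umulFn ∘ fanoutFn (KU d) uN
/-- `1^{kn}`. [folklore] -/
noncomputable def knU : List Bool → List Bool := umulFn ∘ fanoutFn (kU e) uN
/-- `1^{L_in}`, `L_in = 2n + 2 + (|y| + Kn + K)`. [folklore] -/
noncomputable def LinU : List Bool → List Bool :=
  concatFn ∘ fanoutFn (List.cons true ∘ List.cons true ∘ concatFn ∘ fanoutFn uN uN)
    (concatFn ∘ fanoutFn (onesFn ∘ yF) (concatFn ∘ fanoutFn (KnU d) (KU d)))
/-- `1^{K_b}`. [folklore] -/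
noncomputable def KbU : List Bool → List Bool := List.cons true ∘ polyFn qD ∘ LinU d
/-- `1^κ`, `κ = |c| mod K_b`. [folklore] -/
noncomputable def κU : List Bool → List Bool := modLenFn ∘ fanoutFn (KbU qD d) sndF

/-! ### The coin fields -/

/-- `c ⇂ 1`. [folklore] -/
noncomputable def c1 : List Bool → List Bool := dropFn ∘ fanoutFn (fun _ => ones 1) sndF
/-- `[sgn]`. [folklore] -/
noncomputable def sgnB : List Bool → List Bool := headBitFn ∘ takeFn ∘ fanoutFn (fun _ => ones 1) sndF
/-- `mask_J` (`K` bits). [folklore] -/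
noncomputable def maskJF : List Bool → List Bool := CondGen.fitF (KU d) (takeFn ∘ fanoutFn (KU d) (c1))
/-- `c ⇂ (1 + K)`. [folklore] -/
noncomputable def c2 : List Bool → List Bool := dropFn ∘ fanoutFn (KU d) c1
/-- `[β]`. [folklore] -/
noncomputable def βB : List Bool → List Bool := headBitFn ∘ takeFn ∘ fanoutFn (fun _ => ones 1) (c2 d)
/-- The next cut. [folklore] -/
noncomputable def c3 : List Bool → List Bool := dropFn ∘ fanoutFn (fun _ => ones 1) (c2 d)
/-- `ω'` (`Kn` bits). [folklore] -/
noncomputable def ωF : List Bool → List Bool := CondGen.fitF (KnU d) (takeFn ∘ fanoutFn (KnU d) (c3 d))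
/-- The next cut. [folklore] -/
noncomputable def c4 : List Bool → List Bool := dropFn ∘ fanoutFn (KnU d) (c3 d)
/-- `v` (`K` bits). [folklore] -/
noncomputable def vF : List Bool → List Bool := CondGen.fitF (KU d) (takeFn ∘ fanoutFn (KU d) (c4 d))
/-- The next cut. [folklore] -/
noncomputable def c5 : List Bool → List Bool := dropFn ∘ fanoutFn (KU d) (c4 d)
/-- `c_D` (`κ` bits). [folklore] -/
noncomputable def cDF : List Bool → List Bool := CondGen.fitF (κU qD d) (takeFn ∘ fanoutFn (κU qD d) (c5 d))
/-- The next cut. [folklore] -/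
noncomputable def c6 : List Bool → List Bool := dropFn ∘ fanoutFn (κU qD d) (c5 d)
/-- The seeds (`kn` bits). [folklore] -/
noncomputable def SF : List Bool → List Bool := CondGen.fitF (knU e) (takeFn ∘ fanoutFn (knU e) (c6 qD d))
/-- The next cut. [folklore] -/
noncomputable def c7 : List Bool → List Bool := dropFn ∘ fanoutFn (knU e) (c6 qD d)
/-- `τ` (`k` bits). [folklore] -/
noncomputable def τF : List Bool → List Bool := CondGen.fitF (kU e) (takeFn ∘ fanoutFn (kU e) (c7 qD d e))

/-! ### The predictor's precomputed data -/

/-- `1^{j₀}`, `j₀ = firstTrue mask_J`. [folklore] -/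
noncomputable def j0U : List Bool → List Bool := firstTrueFn ∘ maskJF d
/-- The flag `[K ≤ j₀]` (no set bit). [folklore] -/
noncomputable def flagB : List Bool → List Bool := lenLeFn X ∘ fanoutFn (j0U d) (KU d)
/-- `1^{j₀ n}`. [folklore] -/
noncomputable def j0nU : List Bool → List Bool := umulFn ∘ fanoutFn (j0U d) uN
/-- The prefix `ω' ↾ j₀n`. [folklore] -/
noncomputable def preF : List Bool → List Bool := takeFn ∘ fanoutFn (j0nU d) (ωF d)
/-- Block `j₀` of `ω'`. [folklore] -/
noncomputable def blkF : List Bool → List Bool := takeFn ∘ fanoutFn uN (dropFn ∘ fanoutFn (j0nU d) (ωF d))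
/-- The suffix `ω' ⇂ (j₀+1)n`. [folklore] -/
noncomputable def postF : List Bool → List Bool := dropFn ∘ fanoutFn (umulFn ∘ fanoutFn (List.cons true ∘ j0U d) uN) (ωF d)
/-- The masked xor `M` of the blocks of `ω'`. [folklore] -/
noncomputable def MF : List Bool → List Bool := mxFn ∘ fanoutFn (fanoutFn uN (KU d)) (fanoutFn (maskJF d) (ωF d))
/-- The parity `[⊕_{j∈J} v_j]`. [folklore] -/
noncomputable def parJV : List Bool → List Bool := andParityFn ∘ fanoutFn (maskJF d) (vF d)

/-- **The context record** (16 fields):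
`⟨1ⁿ, 1ᵏ, 1^{2^k−1}, y, [sgn], [flag], [β], [par], pre, M, blk, post, v, c_D, S, τ⟩`. [folklore] -/
noncomputable def ctxF : List Bool → List Bool :=
  fanoutFn uN (fanoutFn (kU e) (fanoutFn (twoKm1 e) (fanoutFn yF (fanoutFn sgnB (fanoutFn (flagB d) (fanoutFn (βB d)
    (fanoutFn (parJV d) (fanoutFn (preF d) (fanoutFn (MF d) (fanoutFn (blkF d) (fanoutFn (postF d) (fanoutFn (vF d)
      (fanoutFn (cDF qD d) (fanoutFn (SF qD d e) (τF qD d e)))))))))))))))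

/-- The context record as a function of its fields. [folklore] -/
def ctxRec (n k t : ℕ) (y : List Bool) (sgn flag β par : Bool) (pre M blk post v cD S τ : List Bool) : List Bool :=
  boolPair (ones n) (boolPair (ones k) (boolPair (ones t) (boolPair y (boolPair [sgn] (boolPair [flag] (boolPair [β]
    (boolPair [par] (boolPair pre (boolPair M (boolPair blk (boolPair post (boolPair v (boolPair cD (boolPair S τ))))))))))))))

variable {D qD d e}

/-- `bitsToNat 1ᵏ = 2^k − 1`. [folklore] -/
theorem bitsToNat_ones : ∀ k : ℕ, bitsToNat (ones k) = 2 ^ k - 1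
  | 0 => rfl
  | k + 1 => by
    rw [Com.ones_succ, bitsToNat_cons, bitsToNat_ones k, pow_succ]
    have := Nat.one_le_two_pow (n := k)
    simp; omega

/-- `2^k ≤ 2^{2e+2}(n+1)^{2e+1}` for all `n`. [folklore] -/
theorem two_pow_kof_le_ruler (e n : ℕ) : 2 ^ kof e n ≤ 2 ^ (2 * e + 2) * (n + 1) ^ (2 * e + 1) := by
  have h1 : 2 ^ (Nat.log 2 n + 1) ≤ 2 * (n + 1) := by
    rw [pow_succ, mul_comm]
    refine Nat.mul_le_mul_left 2 ?_
    rcases Nat.eq_zero_or_pos n with rfl | hn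
    · simp
    · exact (Nat.pow_log_le_self 2 hn.ne').trans (Nat.le_succ n)
  have h2 := Nat.pow_le_pow_left h1 (2 * e + 1)
  have h4 : 2 ^ kof e n = 2 * (2 ^ (Nat.log 2 n + 1)) ^ (2 * e + 1) := by
    rw [kof, pow_succ, ← pow_mul, mul_comm (Nat.log 2 n + 1)]; ring
  rw [h4]
  calc 2 * (2 ^ (Nat.log 2 n + 1)) ^ (2 * e + 1) ≤ 2 * (2 * (n + 1)) ^ (2 * e + 1) := Nat.mul_le_mul_left 2 h2
    _ = 2 ^ (2 * e + 2) * (n + 1) ^ (2 * e + 1) := by rw [mul_pow]; ring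

/-- `n = |a|` from the input `⟨a, y⟩`. [folklore] -/
def nOf (inp : List Bool) : ℕ := (boolUnpair inp).1.length
/-- `y` from the input `⟨a, y⟩`. [folklore] -/
def yOf (inp : List Bool) : List Bool := (boolUnpair inp).2

section Values

variable (inp c : List Bool)

/-- Value of `uN`. [folklore] -/
theorem uN_apply : uN (boolPair inp c) = ones (nOf inp) := by simp [uN, fstF, onesFn_eq_ones, nOf]
/-- Value of `yF`. [folklore] -/
theorem yF_apply : yF (boolPair inp c) = yOf inp := by simp [yF, fstF, sndF, yOf]
/-- Value of `KU`. [folklore] -/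
theorem KU_apply : KU d (boolPair inp c) = ones (Kof d (nOf inp)) := by
  simp only [KU, lgU, Function.comp_apply, fanoutFn_apply, uN_apply, logU_apply, List.length_replicate, umulFn_boolPair, Kof]
/-- Value of `kU`. [folklore] -/
theorem kU_apply : kU e (boolPair inp c) = ones (kof e (nOf inp)) := by
  simp only [kU, lgU, Function.comp_apply, fanoutFn_apply, uN_apply, logU_apply, List.length_replicate, true_cons_ones,
    umulFn_boolPair, kof]
/-- Value of `twoKm1`. [folklore] -/
theorem twoKm1_apply : twoKm1 e (boolPair inp c) = ones (2 ^ kof e (nOf inp) - 1) := by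
  simp only [twoKm1, rulerU, Function.comp_apply, fanoutFn_apply, uN_apply, kU_apply, polyFn_apply, List.length_replicate,
    binToUnaryFn_boolPair, bitsToNat_ones, eval_mul, eval_C, eval_pow, eval_add, eval_X, eval_one]
  rw [min_eq_left]
  have := two_pow_kof_le_ruler e (nOf inp)
  omega
/-- Value of `KnU`. [folklore] -/
theorem KnU_apply : KnU d (boolPair inp c) = ones (Kof d (nOf inp) * nOf inp) := by
  simp only [KnU, Function.comp_apply, fanoutFn_apply, KU_apply, uN_apply, umulFn_boolPair]
/-- Value of `knU`. [folklore] -/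
theorem knU_apply : knU e (boolPair inp c) = ones (kof e (nOf inp) * nOf inp) := by
  simp only [knU, Function.comp_apply, fanoutFn_apply, kU_apply, uN_apply, umulFn_boolPair]
/-- Value of `LinU`. [folklore] -/
theorem LinU_apply : LinU d (boolPair inp c) = ones (Lin d (nOf inp) (yOf inp).length) := by
  simp only [LinU, Function.comp_apply, fanoutFn_apply, uN_apply, yF_apply, KnU_apply, KU_apply, concatFn_boolPair, Com.ones_append,
    onesFn_eq_ones, true_cons_ones, Lin]
  congr 1; omega
/-- Value of `κU`. [folklore] -/
theorem κU_apply : κU qD d (boolPair inp c) = ones (c.length % Kb qD d (nOf inp) (yOf inp).length) := by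
  simp only [κU, KbU, Function.comp_apply, fanoutFn_apply, LinU_apply, polyFn_apply, List.length_replicate, true_cons_ones,
    sndF_boolPair, modLenFn_boolPair, Kb]

end Values

/-! ### The model's segments, named -/

section Model

variable (D qD d e)

/-- `K`. [folklore] -/
def K₀ (inp : List Bool) : ℕ := Kof d (nOf inp)
/-- `k`. [folklore] -/
def k₀ (inp : List Bool) : ℕ := kof e (nOf inp)
/-- `κ = |c| mod K_b`. [folklore] -/
def κ₀ (inp c : List Bool) : ℕ := c.length % Kb qD d (nOf inp) (yOf inp).length
/-- `mask_J`. [folklore] -/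
def mMask (inp c : List Bool) : List Bool := CondParams.fitLen ((c.drop 1).take (K₀ d inp)) (K₀ d inp)
/-- The cut after `mask_J`. [folklore] -/
def mc2 (inp c : List Bool) : List Bool := (c.drop 1).drop (K₀ d inp)
/-- `ω'`. [folklore] -/
def mω (inp c : List Bool) : List Bool :=
  CondParams.fitLen (((mc2 d inp c).drop 1).take (K₀ d inp * nOf inp)) (K₀ d inp * nOf inp)
/-- The cut after `ω'`. [folklore] -/
def mc4 (inp c : List Bool) : List Bool := ((mc2 d inp c).drop 1).drop (K₀ d inp * nOf inp)
/-- `v`. [folklore] -/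
def mv (inp c : List Bool) : List Bool := CondParams.fitLen ((mc4 d inp c).take (K₀ d inp)) (K₀ d inp)
/-- The cut after `v`. [folklore] -/
def mc5 (inp c : List Bool) : List Bool := (mc4 d inp c).drop (K₀ d inp)
/-- `c_D`. [folklore] -/
def mcD (inp c : List Bool) : List Bool := CondParams.fitLen ((mc5 d inp c).take (κ₀ qD d inp c)) (κ₀ qD d inp c)
/-- The cut after `c_D`. [folklore] -/
def mc6 (inp c : List Bool) : List Bool := (mc5 d inp c).drop (κ₀ qD d inp c)
/-- The seeds. [folklore] -/
def mS (inp c : List Bool) : List Bool := CondParams.fitLen ((mc6 qD d inp c).take (k₀ e inp * nOf inp)) (k₀ e inp * nOf inp)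
/-- `τ`. [folklore] -/
def mτ (inp c : List Bool) : List Bool :=
  CondParams.fitLen (((mc6 qD d inp c).drop (k₀ e inp * nOf inp)).take (k₀ e inp)) (k₀ e inp)
/-- The string predictor of the run. [folklore] -/
def mB (inp c : List Bool) : List Bool → Bool :=
  predStr D (nOf inp) (K₀ d inp) ((c.take 1).headD false) (mMask d inp c) (((mc2 d inp c).take 1).headD false)
    (mω d inp c) (mv d inp c) (mcD qD d inp c) (yOf inp)

/-- **The run function through the named segments.** [folklore] -/
theorem run_eq (inp c : List Bool) :
    GLInv.run D qD d e inp c = candStr (nOf inp) (k₀ e inp) (mB D qD d inp c) (mS qD d e inp c) (mτ qD d e inp c) := by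
  simp only [GLInv.run, mB, mMask, mc2, mω, mc4, mv, mc5, mcD, mc6, mS, mτ, K₀, k₀, κ₀, nOf, yOf]

end Model

/-! ### Values of the fields -/

section FieldValues

variable (inp c : List Bool)

/-- Value of `c1`. [folklore] -/
theorem c1_apply : c1 (boolPair inp c) = c.drop 1 := by
  simp only [c1, Function.comp_apply, fanoutFn_apply, sndF_boolPair, dropFn_boolPair, List.length_replicate, ones]
/-- Value of `sgnB`. [folklore] -/
theorem sgnB_apply : sgnB (boolPair inp c) = [(c.take 1).headD false] := by
  simp only [sgnB, Function.comp_apply, fanoutFn_apply, sndF_boolPair, takeFn_boolPair, List.length_replicate, ones, headBitFn_apply]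
/-- Value of `maskJF`. [folklore] -/
theorem maskJF_apply : maskJF d (boolPair inp c) = mMask d inp c := by
  simp only [maskJF, Function.comp_apply, fanoutFn_apply, CondGen.fitF_apply, KU_apply, c1_apply, takeFn_boolPair,
    List.length_replicate, mMask, K₀]
/-- Value of `c2`. [folklore] -/
theorem c2_apply : c2 d (boolPair inp c) = mc2 d inp c := by
  simp only [c2, Function.comp_apply, fanoutFn_apply, KU_apply, c1_apply, dropFn_boolPair, List.length_replicate, mc2, K₀]
/-- Value of `βB`. [folklore] -/
theorem βB_apply : βB d (boolPair inp c) = [((mc2 d inp c).take 1).headD false] := by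
  simp only [βB, Function.comp_apply, fanoutFn_apply, c2_apply, takeFn_boolPair, List.length_replicate, ones, headBitFn_apply]
/-- Value of `c3`. [folklore] -/
theorem c3_apply : c3 d (boolPair inp c) = (mc2 d inp c).drop 1 := by
  simp only [c3, Function.comp_apply, fanoutFn_apply, c2_apply, dropFn_boolPair, List.length_replicate, ones]
/-- Value of `ωF`. [folklore] -/
theorem ωF_apply : ωF d (boolPair inp c) = mω d inp c := by
  simp only [ωF, Function.comp_apply, fanoutFn_apply, CondGen.fitF_apply, KnU_apply, c3_apply, takeFn_boolPair,
    List.length_replicate, mω, K₀]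
/-- Value of `c4`. [folklore] -/
theorem c4_apply : c4 d (boolPair inp c) = mc4 d inp c := by
  simp only [c4, Function.comp_apply, fanoutFn_apply, KnU_apply, c3_apply, dropFn_boolPair, List.length_replicate, mc4, K₀]
/-- Value of `vF`. [folklore] -/
theorem vF_apply : vF d (boolPair inp c) = mv d inp c := by
  simp only [vF, Function.comp_apply, fanoutFn_apply, CondGen.fitF_apply, KU_apply, c4_apply, takeFn_boolPair,
    List.length_replicate, mv, K₀]
/-- Value of `c5`. [folklore] -/
theorem c5_apply : c5 d (boolPair inp c) = mc5 d inp c := by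
  simp only [c5, Function.comp_apply, fanoutFn_apply, KU_apply, c4_apply, dropFn_boolPair, List.length_replicate, mc5, K₀]
/-- Value of `cDF`. [folklore] -/
theorem cDF_apply : cDF qD d (boolPair inp c) = mcD qD d inp c := by
  simp only [cDF, Function.comp_apply, fanoutFn_apply, CondGen.fitF_apply, κU_apply, c5_apply, takeFn_boolPair,
    List.length_replicate, mcD, κ₀]
/-- Value of `c6`. [folklore] -/
theorem c6_apply : c6 qD d (boolPair inp c) = mc6 qD d inp c := by
  simp only [c6, Function.comp_apply, fanoutFn_apply, κU_apply, c5_apply, dropFn_boolPair, List.length_replicate, mc6, κ₀]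
/-- Value of `SF`. [folklore] -/
theorem SF_apply : SF qD d e (boolPair inp c) = mS qD d e inp c := by
  simp only [SF, Function.comp_apply, fanoutFn_apply, CondGen.fitF_apply, knU_apply, c6_apply, takeFn_boolPair,
    List.length_replicate, mS, k₀]
/-- Value of `c7`. [folklore] -/
theorem c7_apply : c7 qD d e (boolPair inp c) = (mc6 qD d inp c).drop (k₀ e inp * nOf inp) := by
  simp only [c7, Function.comp_apply, fanoutFn_apply, knU_apply, c6_apply, dropFn_boolPair, List.length_replicate, k₀]
/-- Value of `τF`. [folklore] -/
theorem τF_apply : τF qD d e (boolPair inp c) = mτ qD d e inp c := by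
  simp only [τF, Function.comp_apply, fanoutFn_apply, CondGen.fitF_apply, kU_apply, c7_apply, takeFn_boolPair,
    List.length_replicate, mτ, k₀]
/-- Value of `j0U`. [folklore] -/
theorem j0U_apply : j0U d (boolPair inp c) = ones (firstTrue (mMask d inp c)) := by
  simp only [j0U, Function.comp_apply, maskJF_apply, firstTrueFn_apply]
/-- Value of `flagB`. [folklore] -/
theorem flagB_apply : flagB d (boolPair inp c) = [decide (K₀ d inp ≤ firstTrue (mMask d inp c))] := by
  simp only [flagB, Function.comp_apply, fanoutFn_apply, j0U_apply, KU_apply, lenLeFn_boolPair, List.length_replicate, eval_X, K₀]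
  rfl
/-- Value of `j0nU`. [folklore] -/
theorem j0nU_apply : j0nU d (boolPair inp c) = ones (firstTrue (mMask d inp c) * nOf inp) := by
  simp only [j0nU, Function.comp_apply, fanoutFn_apply, j0U_apply, uN_apply, umulFn_boolPair]
/-- Value of `preF`. [folklore] -/
theorem preF_apply : preF d (boolPair inp c) = (mω d inp c).take (firstTrue (mMask d inp c) * nOf inp) := by
  simp only [preF, Function.comp_apply, fanoutFn_apply, j0nU_apply, ωF_apply, takeFn_boolPair, List.length_replicate]
/-- Value of `blkF`. [folklore] -/
theorem blkF_apply : blkF d (boolPair inp c) = ((mω d inp c).drop (firstTrue (mMask d inp c) * nOf inp)).take (nOf inp) := by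
  simp only [blkF, Function.comp_apply, fanoutFn_apply, j0nU_apply, ωF_apply, uN_apply, takeFn_boolPair, dropFn_boolPair,
    List.length_replicate]
/-- Value of `postF`. [folklore] -/
theorem postF_apply : postF d (boolPair inp c) = (mω d inp c).drop ((firstTrue (mMask d inp c) + 1) * nOf inp) := by
  simp only [postF, Function.comp_apply, fanoutFn_apply, j0U_apply, ωF_apply, uN_apply, true_cons_ones, umulFn_boolPair,
    dropFn_boolPair, List.length_replicate]
/-- Value of `MF`. [folklore] -/
theorem MF_apply : MF d (boolPair inp c) = maskedXor (nOf inp) (K₀ d inp) (mMask d inp c) (mω d inp c) := by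
  simp only [MF, Function.comp_apply, fanoutFn_apply, uN_apply, KU_apply, maskJF_apply, ωF_apply, mxFn_boolPair, K₀]
/-- Value of `parJV`. [folklore] -/
theorem parJV_apply : parJV d (boolPair inp c) = [ipBit (mMask d inp c) (mv d inp c)] := by
  simp only [parJV, Function.comp_apply, fanoutFn_apply, maskJF_apply, vF_apply, andParityFn_boolPair, ipBit_eq_decide_odd]

/-- **The context record on an input.** [folklore] -/
theorem ctxF_boolPair : ctxF qD d e (boolPair inp c) =
    ctxRec (nOf inp) (k₀ e inp) (2 ^ k₀ e inp - 1) (yOf inp) ((c.take 1).headD false) (decide (K₀ d inp ≤ firstTrue (mMask d inp c)))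
      (((mc2 d inp c).take 1).headD false) (ipBit (mMask d inp c) (mv d inp c))
      ((mω d inp c).take (firstTrue (mMask d inp c) * nOf inp)) (maskedXor (nOf inp) (K₀ d inp) (mMask d inp c) (mω d inp c))
      (((mω d inp c).drop (firstTrue (mMask d inp c) * nOf inp)).take (nOf inp)) ((mω d inp c).drop ((firstTrue (mMask d inp c) + 1) * nOf inp))
      (mv d inp c) (mcD qD d inp c) (mS qD d e inp c) (mτ qD d e inp c) := by
  simp only [ctxF, fanoutFn_apply, uN_apply, kU_apply, twoKm1_apply, yF_apply, sgnB_apply, flagB_apply, βB_apply, parJV_apply,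
    preF_apply, MF_apply, blkF_apply, postF_apply, vF_apply, cDF_apply, SF_apply, τF_apply, ctxRec, k₀]

end FieldValues

/-! ### The vote round on `W = ⟨CTX, ⟨e_i, ⟨1ᵖ, count⟩⟩⟩` -/

section Vote

variable (D)

/-- Field `i ≤ 14` of the context (inside `W`). [folklore] -/
def cx (i : ℕ) : List Bool → List Bool := nthF i ∘ fstF
/-- The last field `τ` of the context. [folklore] -/
def cxτ : List Bool → List Bool := sndPow 14 ∘ fstF
/-- The mask of the current `p`: `fitLen (encodeNat p) k`. [folklore] -/
noncomputable def maskP : List Bool → List Bool := CondGen.fitF (cx 1) (lenBinF ∘ nthF 2)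
/-- `r_T = ⊕_{t∈T} s_t`. [folklore] -/
noncomputable def r0F : List Bool → List Bool := mxFn ∘ fanoutFn (fanoutFn (cx 0) (cx 1)) (fanoutFn maskP (cx 14))
/-- `r = r_T ⊕ e_i`. [folklore] -/
noncomputable def qrF : List Bool → List Bool := vxorFn ∘ fanoutFn r0F (nthF 1)
/-- The embedded seed blocks `pre ‖ (r ⊕ M ⊕ blk) ‖ post`. [folklore] -/
noncomputable def σF : List Bool → List Bool :=
  concatFn ∘ fanoutFn (concatFn ∘ fanoutFn (cx 8) (vxorFn ∘ fanoutFn (vxorFn ∘ fanoutFn qrF (cx 9)) (cx 10))) (cx 11)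
/-- `D`'s query `⟨⟨1ⁿ, y ‖ σ ‖ v⟩, c_D⟩`. [folklore] -/
noncomputable def dInF : List Bool → List Bool :=
  fanoutFn (fanoutFn (cx 0) (concatFn ∘ fanoutFn (concatFn ∘ fanoutFn (cx 3) σF) (cx 12))) (cx 13)
/-- `[D's answer]`. [folklore] -/
noncomputable def dBitF : List Bool → List Bool := dStr D ∘ dInF
/-- **The predictor's bit** `[B(r)]`. [folklore] -/
noncomputable def predFB : List Bool → List Bool :=
  iteFn (headBitFn ∘ cx 5) (headBitFn ∘ cx 6) (notFn (xorFn (headBitFn ∘ cx 7) (xorFn (headBitFn ∘ cx 4) (dBitF D))))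
/-- The parity `[⊕_{t∈T} τ_t]`. [folklore] -/
noncomputable def parP : List Bool → List Bool := andParityFn ∘ fanoutFn maskP cxτ
/-- **The vote bit.** [folklore] -/
noncomputable def voteB : List Bool → List Bool := xorFn parP (predFB D)
/-- **The vote round body**: count the vote, advance `p`. [folklore] -/
noncomputable def voteBody : List Bool → List Bool :=
  fanoutFn fstF (fanoutFn (nthF 1) (fanoutFn (List.cons true ∘ nthF 2) (iteFn (voteB D) (List.cons true ∘ sndPow 2) (sndPow 2))))

/-- The record-level predictor (the fields of the context in place of the parsed strings). [folklore] -/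
def predRec (n : ℕ) (y : List Bool) (sgn flag β par : Bool) (pre M blk post v cD : List Bool) (r : List Bool) : Bool :=
  if flag then β else !(Bool.xor par (Bool.xor sgn (D.run (boolPair (ones n) (y ++ (pre ++ vxor (vxor r M) blk ++ post) ++ v)) cD)))

/-- The record-level vote. [folklore] -/
def voteRec (n k : ℕ) (y : List Bool) (sgn flag β par : Bool) (pre M blk post v cD S τ eI : List Bool) (p : ℕ) : Bool :=
  Bool.xor (ipBit (pmask k p) τ) (predRec D n y sgn flag β par pre M blk post v cD (vxor (maskedXor n k (pmask k p) S) eI))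

variable {D}

/-- **One vote round on a state.** [folklore] -/
theorem voteBody_apply (n k t : ℕ) (y : List Bool) (sgn flag β par : Bool) (pre M blk post v cD S τ eI : List Bool) (p m : ℕ) :
    voteBody D (boolPair (ctxRec n k t y sgn flag β par pre M blk post v cD S τ) (boolPair eI (boolPair (ones p) (ones m)))) =
      boolPair (ctxRec n k t y sgn flag β par pre M blk post v cD S τ) (boolPair eI (boolPair (ones (p + 1))
        (ones (m + if voteRec D n k y sgn flag β par pre M blk post v cD S τ eI p then 1 else 0)))) := by
  -- projections of the state
  have P : ∀ (i : ℕ) (rest : List Bool), cx i (boolPair (ctxRec n k t y sgn flag β par pre M blk post v cD S τ) rest) =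
      nthF i (ctxRec n k t y sgn flag β par pre M blk post v cD S τ) := fun i rest => by
    simp only [cx, Function.comp_apply, fstF_boolPair]
  have Pτ : ∀ rest : List Bool, cxτ (boolPair (ctxRec n k t y sgn flag β par pre M blk post v cD S τ) rest) = τ := fun rest => by
    simp only [cxτ, Function.comp_apply, fstF_boolPair, ctxRec, sndPow_succ_boolPair, sndPow_zero_boolPair]
  have F0 : nthF 0 (ctxRec n k t y sgn flag β par pre M blk post v cD S τ) = ones n := by
    simp only [ctxRec, nthF_zero_boolPair]
  have F1 : nthF 1 (ctxRec n k t y sgn flag β par pre M blk post v cD S τ) = ones k := by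
    simp only [ctxRec, nthF_succ_boolPair, nthF_zero_boolPair]
  have F3 : nthF 3 (ctxRec n k t y sgn flag β par pre M blk post v cD S τ) = y := by
    simp only [ctxRec, nthF_succ_boolPair, nthF_zero_boolPair]
  have F4 : nthF 4 (ctxRec n k t y sgn flag β par pre M blk post v cD S τ) = [sgn] := by
    simp only [ctxRec, nthF_succ_boolPair, nthF_zero_boolPair]
  have F5 : nthF 5 (ctxRec n k t y sgn flag β par pre M blk post v cD S τ) = [flag] := by
    simp only [ctxRec, nthF_succ_boolPair, nthF_zero_boolPair]
  have F6 : nthF 6 (ctxRec n k t y sgn flag β par pre M blk post v cD S τ) = [β] := by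
    simp only [ctxRec, nthF_succ_boolPair, nthF_zero_boolPair]
  have F7 : nthF 7 (ctxRec n k t y sgn flag β par pre M blk post v cD S τ) = [par] := by
    simp only [ctxRec, nthF_succ_boolPair, nthF_zero_boolPair]
  have F8 : nthF 8 (ctxRec n k t y sgn flag β par pre M blk post v cD S τ) = pre := by
    simp only [ctxRec, nthF_succ_boolPair, nthF_zero_boolPair]
  have F9 : nthF 9 (ctxRec n k t y sgn flag β par pre M blk post v cD S τ) = M := by
    simp only [ctxRec, nthF_succ_boolPair, nthF_zero_boolPair]
  have F10 : nthF 10 (ctxRec n k t y sgn flag β par pre M blk post v cD S τ) = blk := by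
    simp only [ctxRec, nthF_succ_boolPair, nthF_zero_boolPair]
  have F11 : nthF 11 (ctxRec n k t y sgn flag β par pre M blk post v cD S τ) = post := by
    simp only [ctxRec, nthF_succ_boolPair, nthF_zero_boolPair]
  have F12 : nthF 12 (ctxRec n k t y sgn flag β par pre M blk post v cD S τ) = v := by
    simp only [ctxRec, nthF_succ_boolPair, nthF_zero_boolPair]
  have F13 : nthF 13 (ctxRec n k t y sgn flag β par pre M blk post v cD S τ) = cD := by
    simp only [ctxRec, nthF_succ_boolPair, nthF_zero_boolPair]
  have F14 : nthF 14 (ctxRec n k t y sgn flag β par pre M blk post v cD S τ) = S := by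
    simp only [ctxRec, nthF_succ_boolPair, nthF_zero_boolPair]
  have E1 : ∀ rest : List Bool, nthF 1 (boolPair (ctxRec n k t y sgn flag β par pre M blk post v cD S τ) (boolPair eI rest)) = eI :=
    fun rest => by simp only [nthF_succ_boolPair, nthF_zero_boolPair]
  have E2 : nthF 2 (boolPair (ctxRec n k t y sgn flag β par pre M blk post v cD S τ) (boolPair eI (boolPair (ones p) (ones m)))) = ones p := by
    simp only [nthF_succ_boolPair, nthF_zero_boolPair]
  have E3 : sndPow 2 (boolPair (ctxRec n k t y sgn flag β par pre M blk post v cD S τ) (boolPair eI (boolPair (ones p) (ones m)))) = ones m := by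
    simp only [sndPow_succ_boolPair, sndPow_zero_boolPair]
  -- the computed values
  have hmask : maskP (boolPair (ctxRec n k t y sgn flag β par pre M blk post v cD S τ) (boolPair eI (boolPair (ones p) (ones m)))) = pmask k p := by
    simp only [maskP, CondGen.fitF_apply, P, F1, Function.comp_apply, E2, lenBinF_apply, List.length_replicate, pmask]
  have hr : qrF (boolPair (ctxRec n k t y sgn flag β par pre M blk post v cD S τ) (boolPair eI (boolPair (ones p) (ones m)))) =
      vxor (maskedXor n k (pmask k p) S) eI := by
    simp only [qrF, r0F, Function.comp_apply, fanoutFn_apply, P, F0, F1, F14, hmask, mxFn_boolPair, E1, vxorFn_boolPair]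
  have hpar : parP (boolPair (ctxRec n k t y sgn flag β par pre M blk post v cD S τ) (boolPair eI (boolPair (ones p) (ones m)))) =
      [ipBit (pmask k p) τ] := by
    simp only [parP, Function.comp_apply, fanoutFn_apply, hmask, Pτ, andParityFn_boolPair, ipBit_eq_decide_odd]
  have henc : ∀ b : Bool, encodeBool b = [b] := fun b => by cases b <;> rfl
  have hd : dBitF D (boolPair (ctxRec n k t y sgn flag β par pre M blk post v cD S τ) (boolPair eI (boolPair (ones p) (ones m)))) =
      [D.run (boolPair (ones n) (y ++ (pre ++ vxor (vxor (vxor (maskedXor n k (pmask k p) S) eI) M) blk ++ post) ++ v)) cD] := by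
    simp only [dBitF, dInF, σF, dStr, Function.comp_apply, fanoutFn_apply, P, F0, F3, F8, F9, F10, F11, F12, F13, hr, vxorFn_boolPair,
      concatFn_boolPair, boolUnpair_boolPair, henc]
  have hpred : predFB D (boolPair (ctxRec n k t y sgn flag β par pre M blk post v cD S τ) (boolPair eI (boolPair (ones p) (ones m)))) =
      [predRec D n y sgn flag β par pre M blk post v cD (vxor (maskedXor n k (pmask k p) S) eI)] := by
    unfold predFB predRec
    have h5 : (headBitFn ∘ cx 5) (boolPair (ctxRec n k t y sgn flag β par pre M blk post v cD S τ) (boolPair eI (boolPair (ones p) (ones m)))) = [flag] := by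
      rw [Function.comp_apply, P, F5, headBitFn_apply]; rfl
    have h6 : (headBitFn ∘ cx 6) (boolPair (ctxRec n k t y sgn flag β par pre M blk post v cD S τ) (boolPair eI (boolPair (ones p) (ones m)))) = [β] := by
      rw [Function.comp_apply, P, F6, headBitFn_apply]; rfl
    have h7 : (headBitFn ∘ cx 7) (boolPair (ctxRec n k t y sgn flag β par pre M blk post v cD S τ) (boolPair eI (boolPair (ones p) (ones m)))) = [par] := by
      rw [Function.comp_apply, P, F7, headBitFn_apply]; rfl
    have h4 : (headBitFn ∘ cx 4) (boolPair (ctxRec n k t y sgn flag β par pre M blk post v cD S τ) (boolPair eI (boolPair (ones p) (ones m)))) = [sgn] := by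
      rw [Function.comp_apply, P, F4, headBitFn_apply]; rfl
    have hin := notFn_apply (xorFn_apply h7 (xorFn_apply h4 hd))
    cases flag
    · rw [iteFn_apply_false h5, hin]; rfl
    · rw [iteFn_apply_true h5, h6]; rfl
  have hvote : voteB D (boolPair (ctxRec n k t y sgn flag β par pre M blk post v cD S τ) (boolPair eI (boolPair (ones p) (ones m)))) =
      [voteRec D n k y sgn flag β par pre M blk post v cD S τ eI p] := by
    rw [voteB, xorFn_apply hpar hpred]; rfl
  have hcnt : iteFn (voteB D) (List.cons true ∘ sndPow 2) (sndPow 2)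
      (boolPair (ctxRec n k t y sgn flag β par pre M blk post v cD S τ) (boolPair eI (boolPair (ones p) (ones m)))) =
      ones (m + if voteRec D n k y sgn flag β par pre M blk post v cD S τ eI p then 1 else 0) := by
    cases hv : voteRec D n k y sgn flag β par pre M blk post v cD S τ eI p
    · rw [iteFn_apply_false (by rw [hvote, hv]), E3]; simp
    · rw [iteFn_apply_true (by rw [hvote, hv]), Function.comp_apply, E3, true_cons_ones]; rfl
  rw [voteBody, fanoutFn_apply, fanoutFn_apply, fanoutFn_apply, fstF_boolPair, E1, Function.comp_apply, E2, true_cons_ones, hcnt]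

/-! #### `FP` membership and growth of the vote round -/

/-- `cx i ∈ FP`. [folklore] -/
theorem cx_mem_FP (i : ℕ) : cx i ∈ FP := comp_mem_FP (nthF_mem_FP i) fstF_mem_FP
/-- `cxτ ∈ FP`. [folklore] -/
theorem cxτ_mem_FP : cxτ ∈ FP := comp_mem_FP (sndPow_mem_FP 14) fstF_mem_FP
/-- `maskP ∈ FP`. [folklore] -/
theorem maskP_mem_FP : maskP ∈ FP := CondGen.fitF_mem_FP (cx_mem_FP 1) (comp_mem_FP lenBinF_mem_FP (nthF_mem_FP 2))
/-- `qrF ∈ FP`. [folklore] -/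
theorem qrF_mem_FP : qrF ∈ FP :=
  comp_mem_FP vxorFn_mem_FP' (fanoutFn_mem_FP (comp_mem_FP mxFn_mem_FP (fanoutFn_mem_FP (fanoutFn_mem_FP (cx_mem_FP 0) (cx_mem_FP 1))
    (fanoutFn_mem_FP maskP_mem_FP (cx_mem_FP 14)))) (nthF_mem_FP 1))
/-- `dInF ∈ FP`. [folklore] -/
theorem dInF_mem_FP : dInF ∈ FP :=
  fanoutFn_mem_FP (fanoutFn_mem_FP (cx_mem_FP 0) (comp_mem_FP concatFn_mem_FP (fanoutFn_mem_FP (comp_mem_FP concatFn_mem_FP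
    (fanoutFn_mem_FP (cx_mem_FP 3) (comp_mem_FP concatFn_mem_FP (fanoutFn_mem_FP (comp_mem_FP concatFn_mem_FP (fanoutFn_mem_FP (cx_mem_FP 8)
      (comp_mem_FP vxorFn_mem_FP' (fanoutFn_mem_FP (comp_mem_FP vxorFn_mem_FP' (fanoutFn_mem_FP qrF_mem_FP (cx_mem_FP 9))) (cx_mem_FP 10)))))
      (cx_mem_FP 11))))) (cx_mem_FP 12)))) (cx_mem_FP 13)
/-- `predFB ∈ FP` for `dStr D ∈ FP`. [folklore] -/
theorem predFB_mem_FP (hD : dStr D ∈ FP) : predFB D ∈ FP :=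
  iteFn_mem_FP (comp_mem_FP headBitFn_mem_FP (cx_mem_FP 5)) (comp_mem_FP headBitFn_mem_FP (cx_mem_FP 6))
    (notFn_mem_FP (xorFn_mem_FP (comp_mem_FP headBitFn_mem_FP (cx_mem_FP 7))
      (xorFn_mem_FP (comp_mem_FP headBitFn_mem_FP (cx_mem_FP 4)) (comp_mem_FP hD dInF_mem_FP))))
/-- `parP ∈ FP`. [folklore] -/
theorem parP_mem_FP : parP ∈ FP := comp_mem_FP andParityFn_mem_FP (fanoutFn_mem_FP maskP_mem_FP cxτ_mem_FP)
/-- `voteBody ∈ FP`. [folklore] -/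
theorem voteBody_mem_FP (hD : dStr D ∈ FP) : voteBody D ∈ FP :=
  fanoutFn_mem_FP fstF_mem_FP (fanoutFn_mem_FP (nthF_mem_FP 1) (fanoutFn_mem_FP (comp_mem_FP (cons_mem_FP true) (nthF_mem_FP 2))
    (iteFn_mem_FP (xorFn_mem_FP parP_mem_FP (predFB_mem_FP hD)) (comp_mem_FP (cons_mem_FP true) (sndPow_mem_FP 2)) (sndPow_mem_FP 2))))

/-- `D`'s answer bit is one-bit on every word. [folklore] -/
theorem oneBit_dBitF : OneBit (dBitF D) := fun z =>
  ⟨D.run (boolUnpair (dInF z)).1 (boolUnpair (dInF z)).2, by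
    simp only [dBitF, dStr, Function.comp_apply]; cases D.run (boolUnpair (dInF z)).1 (boolUnpair (dInF z)).2 <;> rfl⟩
/-- The parity is one-bit on every word. [folklore] -/
theorem oneBit_parP : OneBit parP := fun z =>
  ⟨decide (Odd (((maskP z).zipWith (· && ·) (cxτ z)).count true)), by simp only [parP, Function.comp_apply, fanoutFn_apply, andParityFn_boolPair]⟩
/-- The vote is one-bit on every word. [folklore] -/
theorem oneBit_voteB : OneBit (voteB D) :=
  oneBit_xorFn oneBit_parP ((oneBit_headBitFn.comp (cx 5)).ite (oneBit_headBitFn.comp (cx 6))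
    (oneBit_notFn (oneBit_xorFn (oneBit_headBitFn.comp (cx 7)) (oneBit_xorFn (oneBit_headBitFn.comp (cx 4)) oneBit_dBitF))))

/-- **Additive growth of the vote round** (one symbol for `p`, at most one for the count). [folklore] -/
theorem length_voteBody_le (z : List Bool) : (voteBody D z).length ≤ z.length + 9 := by
  have h0 := length_fstF_sndF_le z
  have h1 := length_fstF_sndF_le (sndF z)
  have h2 := length_fstF_sndF_le (sndF (sndF z))
  have e1 : nthF 1 z = fstF (sndF z) := rfl
  have e2 : nthF 2 z = fstF (sndF (sndF z)) := rfl
  have e3 : sndPow 2 z = sndF (sndF (sndF z)) := rfl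
  have hc : (iteFn (voteB D) (List.cons true ∘ sndPow 2) (sndPow 2) z).length ≤ (sndPow 2 z).length + 1 := by
    rw [iteFn_of_oneBit oneBit_voteB]; split_ifs <;> simp
  simp only [voteBody, fanoutFn_apply, Function.comp_apply, length_boolPair, List.length_cons, e1, e2, e3] at *
  omega

/-! ### The vote loop -/

variable (D)

/-- The vote loop on `⟨clock, W⟩`. [folklore] -/
noncomputable def voteRound : List Bool → List Bool := fanoutFn fstF (voteBody D ∘ sndF)

/-- **The vote count** on `V = ⟨CTX, e_i⟩`: `2^k − 1` rounds from `⟨1^{2^k−1}, ⟨CTX, ⟨e_i, ⟨1¹, ε⟩⟩⟩⟩`, then the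
count. [cite: AroraBarak2009, Thm. 9.12] -/
noncomputable def voteLoopF : List Bool → List Bool :=
  sndPow 3 ∘ (fun z => (voteRound D)^[(X : Polynomial ℕ).eval (boolUnpair z).1.length] z) ∘
    fanoutFn (nthF 2 ∘ fstF) (fanoutFn fstF (fanoutFn sndF (fanoutFn (fun _ => [true]) (fun _ => []))))

variable {D}

/-- `voteRound ∈ FP`. [folklore] -/
theorem voteRound_mem_FP (hD : dStr D ∈ FP) : voteRound D ∈ FP :=
  fanoutFn_mem_FP fstF_mem_FP (comp_mem_FP (voteBody_mem_FP hD) sndF_mem_FP)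

/-- Additive growth of `voteRound`. [folklore] -/
theorem length_voteRound_le (w : List Bool) : (voteRound D w).length ≤ w.length + 11 := by
  rw [voteRound, fanoutFn_apply, length_boolPair]
  have h1 := length_fstF_sndF_le w
  have h2 := length_voteBody_le (D := D) (sndF w)
  simp only [Function.comp_apply] at *
  omega

/-- `voteLoopF ∈ FP`. [folklore] -/
theorem voteLoopF_mem_FP (hD : dStr D ∈ FP) : voteLoopF D ∈ FP :=
  comp_mem_FP (sndPow_mem_FP 3) (comp_mem_FP (iterate_mem_FP (voteRound_mem_FP hD) 11 length_voteRound_le X)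
    (fanoutFn_mem_FP (comp_mem_FP (nthF_mem_FP 2) fstF_mem_FP) (fanoutFn_mem_FP fstF_mem_FP (fanoutFn_mem_FP sndF_mem_FP
      (fanoutFn_mem_FP (const_mem_FP _) (const_mem_FP _))))))

/-- Splitting off the first point of an interval count. [folklore] -/
theorem card_filter_Ico_succ (P : ℕ → Prop) [DecidablePred P] (p j : ℕ) :
    ((Finset.Ico p (p + 1 + j)).filter P).card = (if P p then 1 else 0) + ((Finset.Ico (p + 1) (p + 1 + j)).filter P).card := by
  rw [← Finset.insert_Ico_add_one_left_eq_Ico (show p < p + 1 + j by omega), Finset.filter_insert]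
  split_ifs with h
  · rw [Finset.card_insert_of_notMem (by simp), Nat.add_comm]
  · rw [Nat.zero_add]

/-- **The loop invariant**: after `j` rounds from `p`, the counter is `p + j` and the count has
grown by the number of voting `q ∈ [p, p+j)`. [folklore] -/
theorem iterate_voteRound (clk : List Bool) (n k t : ℕ) (y : List Bool) (sgn flag β par : Bool) (pre M blk post v cD S τ eI : List Bool) :
    ∀ (j p m : ℕ), (voteRound D)^[j] (boolPair clk (boolPair (ctxRec n k t y sgn flag β par pre M blk post v cD S τ)
        (boolPair eI (boolPair (ones p) (ones m))))) =
      boolPair clk (boolPair (ctxRec n k t y sgn flag β par pre M blk post v cD S τ) (boolPair eI (boolPair (ones (p + j))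
        (ones (m + ((Finset.Ico p (p + j)).filter fun q => voteRec D n k y sgn flag β par pre M blk post v cD S τ eI q = true).card)))))
  | 0, p, m => by simp
  | j + 1, p, m => by
    rw [Function.iterate_succ_apply, voteRound, fanoutFn_apply, fstF_boolPair, Function.comp_apply, sndF_boolPair, voteBody_apply,
      ← voteRound, iterate_voteRound clk n k t y sgn flag β par pre M blk post v cD S τ eI j (p + 1),
      show p + (j + 1) = p + 1 + j by omega, card_filter_Ico_succ]
    simp only [Nat.add_assoc]

/-- **The vote loop computes the record-level vote count over `[1, 2^k)`** (with `t = 2^k − 1`). [folklore] -/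
theorem voteLoopF_apply (n k : ℕ) (y : List Bool) (sgn flag β par : Bool) (pre M blk post v cD S τ eI : List Bool) :
    voteLoopF D (boolPair (ctxRec n k (2 ^ k - 1) y sgn flag β par pre M blk post v cD S τ) eI) =
      ones (((Finset.Ico 1 (2 ^ k)).filter fun q => voteRec D n k y sgn flag β par pre M blk post v cD S τ eI q = true).card) := by
  have h := iterate_voteRound (D := D) (ones (2 ^ k - 1)) n k (2 ^ k - 1) y sgn flag β par pre M blk post v cD S τ eI (2 ^ k - 1) 1 0
  have h2k : 1 + (2 ^ k - 1) = 2 ^ k := by have := Nat.one_le_two_pow (n := k); omega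
  rw [h2k, zero_add] at h
  have hinit : fanoutFn (nthF 2 ∘ fstF) (fanoutFn fstF (fanoutFn sndF (fanoutFn (fun _ => [true]) (fun _ => []))))
      (boolPair (ctxRec n k (2 ^ k - 1) y sgn flag β par pre M blk post v cD S τ) eI) =
      boolPair (ones (2 ^ k - 1)) (boolPair (ctxRec n k (2 ^ k - 1) y sgn flag β par pre M blk post v cD S τ)
        (boolPair eI (boolPair (ones 1) (ones 0)))) := by
    simp only [fanoutFn_apply, Function.comp_apply, fstF_boolPair, sndF_boolPair, ctxRec, nthF_succ_boolPair, nthF_zero_boolPair]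
    rfl
  simp only [voteLoopF, Function.comp_apply, hinit, boolUnpair_boolPair, List.length_replicate, eval_X, h, sndPow_succ_boolPair,
    sndPow_zero_boolPair]

end Vote

/-! ### The coordinate round on `U = ⟨CTX, ⟨1ⁱ, bits⟩⟩` and the outer loop -/

section Outer

variable (D qD d e)

/-- `e_i = 0^i 1 0^{n−i−1}`. [folklore] -/
noncomputable def eIF : List Bool → List Bool :=
  concatFn ∘ fanoutFn (concatFn ∘ fanoutFn (Kannan.zerosFn ∘ nthF 1) (fun _ => [true]))
    (Kannan.zerosFn ∘ dropFn ∘ fanoutFn (List.cons true ∘ nthF 1) (cx 0))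
/-- The vote count for coordinate `i`. [folklore] -/
noncomputable def cntF : List Bool → List Bool := voteLoopF D ∘ fanoutFn fstF eIF
/-- **The majority bit** `[2^k ≤ 2·count]`. [folklore] -/
noncomputable def bitF : List Bool → List Bool := lenLeFn X ∘ fanoutFn (concatFn ∘ fanoutFn (cntF D) (cntF D)) (List.cons true ∘ cx 2)
/-- **The coordinate round body**: append the bit, advance `i`. [folklore] -/
noncomputable def bitBody : List Bool → List Bool :=
  fanoutFn fstF (fanoutFn (List.cons true ∘ nthF 1) (concatFn ∘ fanoutFn (sndPow 1) (bitF D)))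
/-- The coordinate loop on `⟨clock, U⟩`. [folklore] -/
noncomputable def bitRound : List Bool → List Bool := fanoutFn fstF (bitBody D ∘ sndF)
/-- **The run function of `𝒜_GL` as a string function on `⟨inp, c⟩`**: `n` coordinate rounds from
`⟨1ⁿ, ⟨CTX, ⟨ε, ε⟩⟩⟩`, then the bits. [cite: Goldreich2001, Thm. 2.5.6 (proof, Section 2.5.3)] -/
noncomputable def glRunF : List Bool → List Bool :=
  sndPow 2 ∘ (fun z => (bitRound D)^[(X : Polynomial ℕ).eval (boolUnpair z).1.length] z) ∘
    fanoutFn uN (fanoutFn (ctxF qD d e) (fanoutFn (fun _ => []) (fun _ => [])))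

/-- The record-level count for coordinate `i`. [folklore] -/
noncomputable def cntRec (n k : ℕ) (y : List Bool) (sgn flag β par : Bool) (pre M blk post v cD S τ : List Bool) (i : ℕ) : ℕ :=
  ((Finset.Ico 1 (2 ^ k)).filter fun q => voteRec D n k y sgn flag β par pre M blk post v cD S τ (unitStr n i) q = true).card

/-- The record-level majority bit. [folklore] -/
noncomputable def bitRec (n k : ℕ) (y : List Bool) (sgn flag β par : Bool) (pre M blk post v cD S τ : List Bool) (i : ℕ) : Bool :=
  decide (2 ^ k ≤ 2 * cntRec D n k y sgn flag β par pre M blk post v cD S τ i)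

variable {D qD d e}

/-- **One coordinate round on a state.** [folklore] -/
theorem bitBody_apply (n k : ℕ) (y : List Bool) (sgn flag β par : Bool) (pre M blk post v cD S τ bits : List Bool) (i : ℕ) :
    bitBody D (boolPair (ctxRec n k (2 ^ k - 1) y sgn flag β par pre M blk post v cD S τ) (boolPair (ones i) bits)) =
      boolPair (ctxRec n k (2 ^ k - 1) y sgn flag β par pre M blk post v cD S τ) (boolPair (ones (i + 1))
        (bits ++ [bitRec D n k y sgn flag β par pre M blk post v cD S τ i])) := by
  have h2k := Nat.one_le_two_pow (n := k)
  have heI : eIF (boolPair (ctxRec n k (2 ^ k - 1) y sgn flag β par pre M blk post v cD S τ) (boolPair (ones i) bits)) = unitStr n i := by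
    simp only [eIF, cx, Function.comp_apply, fanoutFn_apply, nthF_succ_boolPair, nthF_zero_boolPair, fstF_boolPair, ctxRec,
      Kannan.zerosFn_apply, List.length_replicate, concatFn_boolPair, true_cons_ones, dropFn_boolPair, Com.drop_ones, unitStr]
    rw [Nat.sub_sub]
  have hcnt : cntF D (boolPair (ctxRec n k (2 ^ k - 1) y sgn flag β par pre M blk post v cD S τ) (boolPair (ones i) bits)) =
      ones (cntRec D n k y sgn flag β par pre M blk post v cD S τ i) := by
    simp only [cntF, Function.comp_apply, fanoutFn_apply, fstF_boolPair, heI, voteLoopF_apply, cntRec]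
  have hc2 : cx 2 (boolPair (ctxRec n k (2 ^ k - 1) y sgn flag β par pre M blk post v cD S τ) (boolPair (ones i) bits)) = ones (2 ^ k - 1) := by
    simp only [cx, Function.comp_apply, fstF_boolPair, ctxRec, nthF_succ_boolPair, nthF_zero_boolPair]
  have hbit : bitF D (boolPair (ctxRec n k (2 ^ k - 1) y sgn flag β par pre M blk post v cD S τ) (boolPair (ones i) bits)) =
      [bitRec D n k y sgn flag β par pre M blk post v cD S τ i] := by
    simp only [bitF, Function.comp_apply, fanoutFn_apply, hcnt, hc2, concatFn_boolPair, Com.ones_append, true_cons_ones,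
      lenLeFn_boolPair, List.length_replicate, eval_X, bitRec]
    rw [Nat.sub_add_cancel h2k, two_mul]
  simp only [bitBody, fanoutFn_apply, Function.comp_apply, fstF_boolPair, nthF_succ_boolPair, nthF_zero_boolPair, true_cons_ones,
    sndPow_succ_boolPair, sndPow_zero_boolPair, concatFn_boolPair, hbit]

/-- `bitBody ∈ FP` for `dStr D ∈ FP`. [folklore] -/
theorem bitBody_mem_FP (hD : dStr D ∈ FP) : bitBody D ∈ FP := by
  have hE : eIF ∈ FP :=
    comp_mem_FP concatFn_mem_FP (fanoutFn_mem_FP (comp_mem_FP concatFn_mem_FP (fanoutFn_mem_FP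
      (comp_mem_FP Kannan.zerosFn_mem_FP (nthF_mem_FP 1)) (const_mem_FP _)))
      (comp_mem_FP Kannan.zerosFn_mem_FP (comp_mem_FP dropFn_mem_FP (fanoutFn_mem_FP (comp_mem_FP (cons_mem_FP true) (nthF_mem_FP 1)) (cx_mem_FP 0)))))
  have hC : cntF D ∈ FP := comp_mem_FP (voteLoopF_mem_FP hD) (fanoutFn_mem_FP fstF_mem_FP hE)
  have hB : bitF D ∈ FP := comp_mem_FP (lenLeFn_mem_FP X) (fanoutFn_mem_FP (comp_mem_FP concatFn_mem_FP (fanoutFn_mem_FP hC hC))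
    (comp_mem_FP (cons_mem_FP true) (cx_mem_FP 2)))
  exact fanoutFn_mem_FP fstF_mem_FP (fanoutFn_mem_FP (comp_mem_FP (cons_mem_FP true) (nthF_mem_FP 1))
    (comp_mem_FP concatFn_mem_FP (fanoutFn_mem_FP (sndPow_mem_FP 1) hB)))

/-- **Additive growth of the coordinate round** (one symbol for `i`, one bit). [folklore] -/
theorem length_bitBody_le (z : List Bool) : (bitBody D z).length ≤ z.length + 7 := by
  have h0 := length_fstF_sndF_le z
  have h1 := length_fstF_sndF_le (sndF z)
  have e1 : nthF 1 z = fstF (sndF z) := rfl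
  have e2 : sndPow 1 z = sndF (sndF z) := rfl
  have hb : (bitF D z).length = 1 := by
    unfold bitF
    rcases lenLeFn_eq_or X (fanoutFn (concatFn ∘ fanoutFn (cntF D) (cntF D)) (List.cons true ∘ cx 2) z) with h | h <;>
      rw [Function.comp_apply, h] <;> rfl
  simp only [bitBody, fanoutFn_apply, Function.comp_apply, length_boolPair, List.length_cons, concatFn_boolPair, List.length_append,
    hb, e1, e2] at *
  omega

/-- `bitRound ∈ FP`. [folklore] -/
theorem bitRound_mem_FP (hD : dStr D ∈ FP) : bitRound D ∈ FP :=
  fanoutFn_mem_FP fstF_mem_FP (comp_mem_FP (bitBody_mem_FP hD) sndF_mem_FP)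

/-- Additive growth of `bitRound`. [folklore] -/
theorem length_bitRound_le (w : List Bool) : (bitRound D w).length ≤ w.length + 9 := by
  rw [bitRound, fanoutFn_apply, length_boolPair]
  have h1 := length_fstF_sndF_le w
  have h2 := length_bitBody_le (D := D) (sndF w)
  simp only [Function.comp_apply] at *
  omega

/-- **The loop invariant of the coordinate loop.** [folklore] -/
theorem iterate_bitRound (clk : List Bool) (n k : ℕ) (y : List Bool) (sgn flag β par : Bool) (pre M blk post v cD S τ : List Bool) :
    ∀ (j i : ℕ) (bits : List Bool), (bitRound D)^[j] (boolPair clk (boolPair (ctxRec n k (2 ^ k - 1) y sgn flag β par pre M blk post v cD S τ)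
        (boolPair (ones i) bits))) =
      boolPair clk (boolPair (ctxRec n k (2 ^ k - 1) y sgn flag β par pre M blk post v cD S τ) (boolPair (ones (i + j))
        (bits ++ (List.range' i j).map (bitRec D n k y sgn flag β par pre M blk post v cD S τ))))
  | 0, i, bits => by simp
  | j + 1, i, bits => by
    rw [Function.iterate_succ_apply, bitRound, fanoutFn_apply, fstF_boolPair, Function.comp_apply, sndF_boolPair, bitBody_apply,
      ← bitRound, iterate_bitRound clk n k y sgn flag β par pre M blk post v cD S τ j (i + 1), List.range'_succ, List.map_cons,
      List.append_assoc, List.singleton_append, show i + 1 + j = i + (j + 1) by omega]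

/-- **The record-level predictor is the string predictor** when the record holds the parsed data. [folklore] -/
theorem predRec_eq (n K : ℕ) (sgn β : Bool) (maskJ ω' v cD y : List Bool) :
    predRec D n y sgn (decide (K ≤ firstTrue maskJ)) β (ipBit maskJ v) (ω'.take (firstTrue maskJ * n)) (maskedXor n K maskJ ω')
      ((ω'.drop (firstTrue maskJ * n)).take n) (ω'.drop ((firstTrue maskJ + 1) * n)) v cD = predStr D n K sgn maskJ β ω' v cD y := by
  funext r
  unfold predRec predStr σStr
  rw [unaryEncodeNat_eq_ones]
  by_cases h : K ≤ firstTrue maskJ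
  · rw [if_pos h, decide_eq_true h, if_pos rfl]
  · rw [if_neg h, decide_eq_false h, if_neg (by decide)]

/-- **`glRunF ⟨inp, c⟩ = GLInv.run D q_D d e inp c`.** [cite: Goldreich2001, Thm. 2.5.6 (proof, Section 2.5.3)] -/
theorem glRunF_boolPair (inp c : List Bool) : glRunF D qD d e (boolPair inp c) = GLInv.run D qD d e inp c := by
  have hinit : fanoutFn uN (fanoutFn (ctxF qD d e) (fanoutFn (fun _ => []) (fun _ => []))) (boolPair inp c) =
      boolPair (ones (nOf inp)) (boolPair (ctxF qD d e (boolPair inp c)) (boolPair (ones 0) [])) := by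
    simp only [fanoutFn_apply, uN_apply]; rfl
  rw [run_eq, glRunF, Function.comp_apply, Function.comp_apply, hinit, boolUnpair_boolPair, List.length_replicate, eval_X,
    ctxF_boolPair, iterate_bitRound, zero_add, List.nil_append, sndPow_succ_boolPair, sndPow_succ_boolPair, sndPow_zero_boolPair,
    candStr, List.ofFn_eq_map]
  rw [show List.range' 0 (nOf inp) = List.range (nOf inp) from List.range_eq_range'.symm,
    ← List.map_coe_finRange_eq_range, List.map_map]
  refine List.map_congr_left fun i _ => ?_
  simp only [Function.comp_apply, bitRec, cntRec, candBit, voteCount, vote, voteRec, mB, predRec_eq]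
  rw [decide_eq_decide]
  have := Nat.one_le_two_pow (n := k₀ e inp)
  omega

/-- **`glRunF ∈ FP`** for `dStr D ∈ FP`. [folklore] -/
theorem glRunF_mem_FP (hD : dStr D ∈ FP) : glRunF D qD d e ∈ FP := by
  have huN : uN ∈ FP := comp_mem_FP onesFn_mem_FP (comp_mem_FP fstF_mem_FP fstF_mem_FP)
  have hy : yF ∈ FP := comp_mem_FP sndF_mem_FP fstF_mem_FP
  have hlg : lgU ∈ FP := comp_mem_FP logU_mem_FP huN
  have hK : KU d ∈ FP := comp_mem_FP umulFn_mem_FP (fanoutFn_mem_FP (const_mem_FP _) hlg)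
  have hk : kU e ∈ FP := comp_mem_FP (cons_mem_FP true) (comp_mem_FP umulFn_mem_FP (fanoutFn_mem_FP (const_mem_FP _) (comp_mem_FP (cons_mem_FP true) hlg)))
  have htwo : twoKm1 e ∈ FP := comp_mem_FP binToUnaryFn_mem_FP (fanoutFn_mem_FP (comp_mem_FP (polyFn_mem_FP _) huN) hk)
  have hKn : KnU d ∈ FP := comp_mem_FP umulFn_mem_FP (fanoutFn_mem_FP hK huN)
  have hkn : knU e ∈ FP := comp_mem_FP umulFn_mem_FP (fanoutFn_mem_FP hk huN)
  have hLin : LinU d ∈ FP := comp_mem_FP concatFn_mem_FP (fanoutFn_mem_FP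
    (comp_mem_FP (cons_mem_FP true) (comp_mem_FP (cons_mem_FP true) (comp_mem_FP concatFn_mem_FP (fanoutFn_mem_FP huN huN))))
    (comp_mem_FP concatFn_mem_FP (fanoutFn_mem_FP (comp_mem_FP onesFn_mem_FP hy) (comp_mem_FP concatFn_mem_FP (fanoutFn_mem_FP hKn hK)))))
  have hκ : κU qD d ∈ FP := comp_mem_FP modLenFn_mem_FP (fanoutFn_mem_FP (comp_mem_FP (cons_mem_FP true) (comp_mem_FP (polyFn_mem_FP _) hLin)) sndF_mem_FP)
  have h1 : c1 ∈ FP := comp_mem_FP dropFn_mem_FP (fanoutFn_mem_FP (const_mem_FP _) sndF_mem_FP)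
  have hsgn : sgnB ∈ FP := comp_mem_FP headBitFn_mem_FP (comp_mem_FP takeFn_mem_FP (fanoutFn_mem_FP (const_mem_FP _) sndF_mem_FP))
  have hmask : maskJF d ∈ FP := CondGen.fitF_mem_FP hK (comp_mem_FP takeFn_mem_FP (fanoutFn_mem_FP hK h1))
  have h2 : c2 d ∈ FP := comp_mem_FP dropFn_mem_FP (fanoutFn_mem_FP hK h1)
  have hβ : βB d ∈ FP := comp_mem_FP headBitFn_mem_FP (comp_mem_FP takeFn_mem_FP (fanoutFn_mem_FP (const_mem_FP _) h2))
  have h3 : c3 d ∈ FP := comp_mem_FP dropFn_mem_FP (fanoutFn_mem_FP (const_mem_FP _) h2)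
  have hω : ωF d ∈ FP := CondGen.fitF_mem_FP hKn (comp_mem_FP takeFn_mem_FP (fanoutFn_mem_FP hKn h3))
  have h4 : c4 d ∈ FP := comp_mem_FP dropFn_mem_FP (fanoutFn_mem_FP hKn h3)
  have hv : vF d ∈ FP := CondGen.fitF_mem_FP hK (comp_mem_FP takeFn_mem_FP (fanoutFn_mem_FP hK h4))
  have h5 : c5 d ∈ FP := comp_mem_FP dropFn_mem_FP (fanoutFn_mem_FP hK h4)
  have hcD : cDF qD d ∈ FP := CondGen.fitF_mem_FP hκ (comp_mem_FP takeFn_mem_FP (fanoutFn_mem_FP hκ h5))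
  have h6 : c6 qD d ∈ FP := comp_mem_FP dropFn_mem_FP (fanoutFn_mem_FP hκ h5)
  have hS : SF qD d e ∈ FP := CondGen.fitF_mem_FP hkn (comp_mem_FP takeFn_mem_FP (fanoutFn_mem_FP hkn h6))
  have h7 : c7 qD d e ∈ FP := comp_mem_FP dropFn_mem_FP (fanoutFn_mem_FP hkn h6)
  have hτ : τF qD d e ∈ FP := CondGen.fitF_mem_FP hk (comp_mem_FP takeFn_mem_FP (fanoutFn_mem_FP hk h7))
  have hj0 : j0U d ∈ FP := comp_mem_FP firstTrueFn_mem_FP hmask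
  have hflag : flagB d ∈ FP := comp_mem_FP (lenLeFn_mem_FP X) (fanoutFn_mem_FP hj0 hK)
  have hj0n : j0nU d ∈ FP := comp_mem_FP umulFn_mem_FP (fanoutFn_mem_FP hj0 huN)
  have hpre : preF d ∈ FP := comp_mem_FP takeFn_mem_FP (fanoutFn_mem_FP hj0n hω)
  have hblk : blkF d ∈ FP := comp_mem_FP takeFn_mem_FP (fanoutFn_mem_FP huN (comp_mem_FP dropFn_mem_FP (fanoutFn_mem_FP hj0n hω)))
  have hpost : postF d ∈ FP := comp_mem_FP dropFn_mem_FP (fanoutFn_mem_FP (comp_mem_FP umulFn_mem_FP (fanoutFn_mem_FP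
    (comp_mem_FP (cons_mem_FP true) hj0) huN)) hω)
  have hM : MF d ∈ FP := comp_mem_FP mxFn_mem_FP (fanoutFn_mem_FP (fanoutFn_mem_FP huN hK) (fanoutFn_mem_FP hmask hω))
  have hpar : parJV d ∈ FP := comp_mem_FP andParityFn_mem_FP (fanoutFn_mem_FP hmask hv)
  have hctx : ctxF qD d e ∈ FP :=
    fanoutFn_mem_FP huN (fanoutFn_mem_FP hk (fanoutFn_mem_FP htwo (fanoutFn_mem_FP hy (fanoutFn_mem_FP hsgn (fanoutFn_mem_FP hflag
      (fanoutFn_mem_FP hβ (fanoutFn_mem_FP hpar (fanoutFn_mem_FP hpre (fanoutFn_mem_FP hM (fanoutFn_mem_FP hblk (fanoutFn_mem_FP hpost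
        (fanoutFn_mem_FP hv (fanoutFn_mem_FP hcD (fanoutFn_mem_FP hS hτ))))))))))))))
  exact comp_mem_FP (sndPow_mem_FP 2) (comp_mem_FP (iterate_mem_FP (bitRound_mem_FP hD) 9 length_bitRound_le X)
    (fanoutFn_mem_FP huN (fanoutFn_mem_FP hctx (fanoutFn_mem_FP (const_mem_FP _) (const_mem_FP _)))))

end Outer

end GLProg

/-- **Discharge of `GLInv.glInvRun_polyTime`**: for every PPT distinguisher `D`, the run function
of the Goldreich–Levin inverter `𝒜_GL` is polynomial time on the pair presentation of
(input, coins) — the `FP` pipeline `GLProg.glRunF` around the calls of `D`.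
[cite: Goldreich2001, Thm. 2.5.6 (proof, Section 2.5.3)] -/
theorem GLInv.glInvRun_polyTime_holds : GLInv.glInvRun_polyTime := by
  intro D qD d e hD
  have h1 : PolyTimeComputable (fun p : List Bool × List Bool => boolPair p.1 p.2) encodeBool
      (fun p : List Bool × List Bool => D.run p.1 p.2) := by
    obtain ⟨p, M, hM⟩ := hD.1
    exact ⟨p, M, fun a => hM a⟩
  have hd : dStr D ∈ FP := PolyTimeComputable.comp_holds h1 polyTimeComputable_boolUnpair
  obtain ⟨p, M, hM⟩ := GLProg.glRunF_mem_FP (D := D) (qD := qD) (d := d) (e := e) hd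
  refine ⟨p, M, fun q => ?_⟩
  have hrun := hM (boolPair q.1 q.2)
  simp only [id_eq] at hrun
  rw [GLProg.glRunF_boolPair] at hrun
  exact hrun

end Literature.Computability.Cryptography
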